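import Summits.BirchSwinnertonDyer.BirchSwinnertonDyer.Theorems.UniversalToricDescentTwinReadoutIndexThree
import Summits.BirchSwinnertonDyer.BirchSwinnertonDyer.Theorems.UniversalToricDescentTowerNoPTorsion
import Summits.BirchSwinnertonDyer.BirchSwinnertonDyer.Theorems.UniversalToricDescentTwinTateLineAtThree
import Summits.BirchSwinnertonDyer.BirchSwinnertonDyer.Theorems.PrintX9MuPartStabilizedOfSpecWitnesses
import Literature.NumberTheory.EllipticCurves.IwasawaSelmerDualProofs
import Literature.NumberTheory.EllipticCurves.IwasawaSelmerModuleFiniteProofs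
import HarnessLib

/-!
# (H-iii) of the K2 stub from HOWARD'S CONCLUSION at the control levels of the class: `Stmt.conclusionAtControlLevels`,
# `hasSpecWitnesses_of_conclusion`, `card_bound_of_conclusion`, and the twin at `p = 3`: `twin_hKS_of_conclusion`

Summits-side helper toward the registered stub `stub_howardOutputsOfFamily` (K2) of line `beta-road` (skeleton v10
cd44fe9d5c6b9a78) of crux r205 stmt-BirchSwinnertonDyer-24737 `…Theses.UniversalToricDescent.TwinAlgMuZeroAtThree` (LEAD
lineage `bsd-wall-utd-p1`, g26; `--supports`).  ROUTE-INDEPENDENT; ONE statement abbreviation (a predicate, nothing asserted)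
and theorems; no named fact, no instance, no `sorry`.

The K2 stub's third conjunct (H-iii) is the m-UNIFORM specialised index inequality
`∃ C′ m₀, ∀ m ≥ m₀, #(X_tors/q_m) ≤ 3^{C′}·#((𝔖/Λz)/q_m)²` (`q_m = T^m + 3`).  With the control glue for the twin PROVED
(`UniversalToricDescentTwinReadoutIndex.controlGlueMultAt_three`, p765199: (B4) p764670, (B5) at `3`), (H-iii) follows from ONE
input — **Howard's `Conclusion` of Thm. 1.6.1 for the Eisenstein settings `S_m` of the twin at the control levels of `z`, for all
large `m`** — which is exactly what the Kolyvagin-system side of K2 (KS-twin + `SatisfiesH` (g25, proved) + `LargePrimes` (generic)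
+ Thm. 1.6.1 = F-161′) is to deliver.  This file names that input and performs the deduction:
* `Stmt.conclusionAtControlLevels p N W K κ γ hγ hE D z` — the PREDICATE «∃ m₀ ∀ m ≥ m₀ ∃ admissible Eisenstein datum
  `(S, 𝓛, jbar′, cd, Dd, fs, t, I)` with `SatisfiesH`, Howard's `Conclusion` holds at `(I.proj (k+1) (f_m z))_k`» (the shape in
  which x9's `Stmt.howardInputsCore` + F-161′ produce it; a hypothesis shape, not a citable fact);
* **`hasSpecWitnesses_of_conclusion`** — `Stmt.controlGlueMultAt p` + the predicate ⟹ `HasSpecWitnesses p 𝔖 X (Λ∙z)` (any frame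
  where the glue holds; `𝔖` f.g., `z ≠ 0`, `𝔖/Λz` torsion);
* **`card_bound_of_conclusion`** — ⟹ the index inequality (x9's `exists_card_bound_of_specWitnesses`);
* **`twin_hKS_of_conclusion`** — in the binders of crux 24737 (`Rank1Residual.Mult W′ 3`, `ρ̄₃` onto, `K` imaginary quadratic
  Heegner for `N′`, `κ` anticyclotomic, `γ` a topological generator): the predicate at `p = 3` for `(Dat, z)` ⟹ conjunct (H-iii) of
  `stub_howardOutputsOfFamily` VERBATIM (`X = (W′.baseChange K).selmerDualData κ hγ`), unconditionally — glue p765199,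
  `E(K)[3] = 0` by `UniversalToricDescentTowerTorsion.baseChange_noPTorsion_of_surjective`, multiplicative reduction above `3` by
  `UniversalToricDescentTwinTateLineAtThree.hasMultiplicativeReductionAt_baseChange_of_mult_three`.
What this is NOT: the predicate itself for the twin (KS-twin beyond print + F-161′), (H-i′), (H-ii), K1, C₀.  No summit statement is
proved; BSD is not proved by any of this.

References: [Howard2004HeegnerKolyvagin] Thm. 1.6.1, Prop. 2.2.8 and proof of Thm. 2.2.10 (𝔮 = T^m + p); [GreenbergLNM1716] §1 p. 60.
-/

set_option linter.dupNamespace false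
set_option autoImplicit false

noncomputable section

open scoped Classical Pointwise ContRepresentation TensorProduct NumberField

open Function NumberField IsDedekindDomain Field
open Literature Literature.NumberTheory.EllipticCurves WeierstrassCurve
open Literature.NumberTheory.GaloisCohomology Literature.NumberTheory.GaloisCohomology.Howard2004
open Literature.NumberTheory.GaloisRepresentations Literature.NumberTheory.GaloisRepresentations.DiscreteGaloisModule
open Summit.BirchSwinnertonDyer.BirchSwinnertonDyer.Theorems
open Summit.BirchSwinnertonDyer.BirchSwinnertonDyer.Theorems.UniversalToricDescentTwinControlGlue

namespace Summit.BirchSwinnertonDyer.BirchSwinnertonDyer.Theorems.UniversalToricDescentTwinHowardConclusion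

/-! ## §1 The input predicate: Howard's conclusion at the control levels of `z`, for all large `m` -/

set_option synthInstance.maxHeartbeats 80000 in
/-- **`Stmt.conclusionAtControlLevels p N W K κ γ hγ hE D z`** — for all `m ≥ m₀` there is an admissible Eisenstein datum at
`q_m = T^m + p` (place set `S` between the places above `p` and those above `pN`, `Aut(K/ℚ)`-stable; `𝓛` off `S`; `jbar′`;
conjugation datum `cd`; H.4 data `Dd`; finite–singular slots `fs`; tower pin `(t, ht, I)`) whose setting
`W.eisensteinDVRSetting (κ.unitTwist (-1)) hm S … fs` satisfies Howard's H.0–H.5 (`hy`) AND Howard's `Conclusion hy` (Thm. 1.6.1: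
`H¹_F(K, T_𝔮)` free of rank one, `H¹_F(K, A_𝔮) ≅ 𝒟 ⊕ M ⊕ M`, `length M ≤ length S_𝔮/S_𝔮·r₁`) at the control levels
`(I.proj (k+1) (f_m z))_k` of the class `z ∈ 𝔖 = D.S`.  A hypothesis SHAPE (what a Kolyvagin system with bottom class `f_m z ≠ 0`
gives through Thm. 1.6.1); nothing is asserted. -/
abbrev Stmt.conclusionAtControlLevels (p : ℕ) [Fact p.Prime] (N : ℕ) (W : WeierstrassCurve ℚ) [W.IsElliptic]
    (K : Type) [Field K] [NumberField K] (κ : ZpExtension K p) (γ : Field.absoluteGaloisGroup K)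
    (hγ : κ.IsTopGenerator γ) (hE : ∀ Q : (W.baseChange K).toAffine.Point, p • Q = 0 → Q = 0)
    (D : (W.baseChange K).LambdaAdicSelmerData κ γ) (z : D.S) : Prop :=
  ∃ m₀ : ℕ, ∀ (m : ℕ) (hm : 1 ≤ m), m₀ ≤ m →
    letI := IwasawaAlgebra.isDomain_quotient_X_pow_add_C p hm
    letI := IwasawaAlgebra.isDiscreteValuationRing_quotient_X_pow_add_C p hm
    haveI := IwasawaAlgebra.EisensteinCoeff.isLocalRing_succ p hm
    letI := IwasawaAlgebra.EisensteinCoeff.algebraOfSpecSucc p m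
    haveI := W.isScalarTower_algebraOfSpecSucc (K := K) (p := p) (m := m)
    letI := W.residueModuleSucc (K := K) (p := p) hm
    ∃ (S : Finset (IsDedekindDomain.HeightOneSpectrum (NumberField.RingOfIntegers K)))
      (hpS : ∀ v, ((p : ℕ) : NumberField.RingOfIntegers K) ∈ v.asIdeal → v ∈ S)
      (hbad : ∀ v, v ∉ S → ((p : ℕ) : NumberField.RingOfIntegers K) ∉ v.asIdeal →
        (W.baseChange K).HasGoodReductionAt v)
      (_hSN : ∀ v ∈ S, ((p : ℕ) : NumberField.RingOfIntegers K) ∈ v.asIdeal ∨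
        ((N : ℕ) : NumberField.RingOfIntegers K) ∈ v.asIdeal)
      (_hSσ : ∀ (σ : K ≃ₐ[ℚ] K) (v : IsDedekindDomain.HeightOneSpectrum (NumberField.RingOfIntegers K)),
        σ • v ∈ S → v ∈ S)
      (L : Set (IsDedekindDomain.HeightOneSpectrum (NumberField.RingOfIntegers K)))
      (hL : L ⊆ (W.eisensteinTower (κ.unitTwist (-1)) hm).degreeTwoPrimes p)
      (hLS : ∀ v ∈ L, v ∉ S) (jbar' : AlgebraicClosure K →+* ℂ) (cd : ConjugationDatum K)
      (Dd : ∀ k, DualityDatum p cd ((W.eisensteinTower (κ.unitTwist (-1)) hm).ρ k)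
        (IwasawaAlgebra.EisensteinCoeff p m (k + 1)))
      (fs : ∀ (k : ℕ) (n : Finset (IsDedekindDomain.HeightOneSpectrum (NumberField.RingOfIntegers K)))
        (v : IsDedekindDomain.HeightOneSpectrum (NumberField.RingOfIntegers K)),
        galoisCohomology ((W.eisensteinLevelQuot (κ.unitTwist (-1)) hm k n).toLocal (Sum.inr v)) 1 →+
          SingularQuotient (GaloisRep.toLocal v (W.eisensteinLevelQuot (κ.unitTwist (-1)) hm k n)) ⊗[ℤ]
            Gell v)
      (t : ∀ k, ((W.baseChange K).torsionGaloisModule ((p : ℤ) ^ (k + 1))).toContRepresentation →ⁱL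
        ((W.baseChange K).torsionGaloisModule ((p : ℤ) ^ k)).toContRepresentation)
      (ht : ∀ k (P : geomTorsion (W.baseChange K) ((p : ℤ) ^ (k + 1))),
        t k P = (W.baseChange K).geomTorsionReduce p k P)
      (I : ZpExtension.EisensteinH1Data (κ.unitTwist (-1))
        (fun k ↦ (W.baseChange K).torsionGaloisModule ((p : ℤ) ^ k)) t hm)
      (hy : (W.eisensteinDVRSetting (κ.unitTwist (-1)) hm S hpS hbad L hL hLS jbar' cd Dd fs).SatisfiesH),
      (W.eisensteinDVRSetting (κ.unitTwist (-1)) hm S hpS hbad L hL hLS jbar' cd Dd fs).Conclusion hy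
        (fun k ↦ I.proj (k + 1) (D.toEisensteinH1Linear hm t ht I hγ hE z))

/-! ## §2 Glue + conclusion ⟹ witnesses ⟹ the index inequality -/

set_option maxHeartbeats 800000 in
set_option synthInstance.maxHeartbeats 80000 in
/-- **Witnesses from the glue and Howard's conclusion.**  If the control glue holds at `p` on the twin frame
(`Stmt.controlGlueMultAt p`; at `p = 3` this is the theorem `controlGlueMultAt_three`) and Howard's conclusion holds at the control
levels of `z` for all large `m`, then `HasSpecWitnesses p 𝔖 X (Λ∙z)` for every dual datum `X` (`𝔖` f.g., `z ≠ 0`, `𝔖/Λz` torsion).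
[cite: Howard2004HeegnerKolyvagin, Thm. 1.6.1, Prop. 2.2.8 and proof of Thm. 2.2.10 (𝔮 = T^m + p)] -/
theorem hasSpecWitnesses_of_conclusion {p : ℕ} [Fact p.Prime] (hglue : Stmt.controlGlueMultAt p)
    (N : ℕ) [NeZero N] (W : WeierstrassCurve ℚ) [W.IsElliptic] [W.IsGloballyMinimal]
    (K : Type) [Field K] [NumberField K] (κ : ZpExtension K p) (γ : Field.absoluteGaloisGroup K)
    (hK : IsImaginaryQuadratic K) (hp2 : p ≠ 2) (hκ : κ.IsAnticyclotomic) (hHeeg : SatisfiesHeegnerHypothesis N K)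
    (hγ : κ.IsTopGenerator γ) (hE : ∀ Q : (W.baseChange K).toAffine.Point, p • Q = 0 → Q = 0)
    (hmultp : ∀ v : IsDedekindDomain.HeightOneSpectrum (NumberField.RingOfIntegers K),
      ((p : ℕ) : NumberField.RingOfIntegers K) ∈ v.asIdeal → (W.baseChange K).HasMultiplicativeReductionAt v)
    (D : (W.baseChange K).LambdaAdicSelmerData κ γ) (X : (W.baseChange K).SelmerDualData κ γ) (z : D.S)
    (hfin : Module.Finite (IwasawaAlgebra p) D.S)
    (htor : Module.IsTorsion (IwasawaAlgebra p) (D.S ⧸ Submodule.span (IwasawaAlgebra p) {z})) (hz0 : z ≠ 0)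
    (hconc : Stmt.conclusionAtControlLevels p N W K κ γ hγ hE D z) :
    HeegnerMuPartStabilized.HasSpecWitnesses p D.S X.X (Submodule.span (IwasawaAlgebra p) {z}) := by
  obtain ⟨c, m₁, hg⟩ := hglue N W K κ γ hK hp2 hκ hHeeg hγ hE hmultp D X z hfin htor hz0
  obtain ⟨m₀, hc⟩ := hconc
  refine ⟨c, m₀ + m₁ + 1, fun m hmle ↦ ?_⟩
  have hm : 1 ≤ m := by omega
  have hm₀ : m₀ ≤ m := by omega
  have hm₁ : m₁ ≤ m := by omega
  obtain ⟨S, hpS, hbad, hSN, hSσ, L, hL, hLS, jbar', cd, Dd, fs, t, ht, I, hy, hconcl⟩ := hc m hm hm₀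
  exact hg m hm hm₁ S hpS hbad hSN hSσ L hL hLS jbar' cd Dd fs t ht I hy hconcl

/-- **The m-uniform specialised index inequality from the glue and Howard's conclusion**:
`∃ C′ m₀, ∀ m ≥ m₀, #(X_tors/q_m) ≤ p^{C′}·#((𝔖/Λz)/q_m)²` (x9's `exists_card_bound_of_specWitnesses` after
`hasSpecWitnesses_of_conclusion`; `X` f.g.). [cite: Howard2004HeegnerKolyvagin, Thm. 1.6.1 and proof of Thm. 2.2.10 (𝔮 = T^m + p)] -/
theorem card_bound_of_conclusion {p : ℕ} [Fact p.Prime] (hglue : Stmt.controlGlueMultAt p)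
    (N : ℕ) [NeZero N] (W : WeierstrassCurve ℚ) [W.IsElliptic] [W.IsGloballyMinimal]
    (K : Type) [Field K] [NumberField K] (κ : ZpExtension K p) (γ : Field.absoluteGaloisGroup K)
    (hK : IsImaginaryQuadratic K) (hp2 : p ≠ 2) (hκ : κ.IsAnticyclotomic) (hHeeg : SatisfiesHeegnerHypothesis N K)
    (hγ : κ.IsTopGenerator γ) (hE : ∀ Q : (W.baseChange K).toAffine.Point, p • Q = 0 → Q = 0)
    (hmultp : ∀ v : IsDedekindDomain.HeightOneSpectrum (NumberField.RingOfIntegers K),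
      ((p : ℕ) : NumberField.RingOfIntegers K) ∈ v.asIdeal → (W.baseChange K).HasMultiplicativeReductionAt v)
    (D : (W.baseChange K).LambdaAdicSelmerData κ γ) (X : (W.baseChange K).SelmerDualData κ γ) (z : D.S)
    [Module.Finite (IwasawaAlgebra p) D.S] [Module.Finite (IwasawaAlgebra p) X.X]
    (htor : Module.IsTorsion (IwasawaAlgebra p) (D.S ⧸ Submodule.span (IwasawaAlgebra p) {z})) (hz0 : z ≠ 0)
    (hconc : Stmt.conclusionAtControlLevels p N W K κ γ hγ hE D z) :
    ∃ C' m₀ : ℕ, ∀ m : ℕ, m₀ ≤ m →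
      Nat.card (↥(Submodule.torsion (IwasawaAlgebra p) X.X) ⧸
        (Ideal.span {(PowerSeries.X ^ m + PowerSeries.C (p : ℤ_[p]) : IwasawaAlgebra p)} • ⊤ :
          Submodule (IwasawaAlgebra p) ↥(Submodule.torsion (IwasawaAlgebra p) X.X))) ≤
      p ^ C' * Nat.card ((D.S ⧸ Submodule.span (IwasawaAlgebra p) {z}) ⧸
        (Ideal.span {(PowerSeries.X ^ m + PowerSeries.C (p : ℤ_[p]) : IwasawaAlgebra p)} • ⊤ :
          Submodule (IwasawaAlgebra p) (D.S ⧸ Submodule.span (IwasawaAlgebra p) {z}))) ^ 2 :=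
  HeegnerMuPartStabilized.exists_card_bound_of_specWitnesses p (Submodule.span (IwasawaAlgebra p) {z}) htor
    (hasSpecWitnesses_of_conclusion hglue N W K κ γ hK hp2 hκ hHeeg hγ hE hmultp D X z inferInstance htor hz0 hconc)

/-! ## §3 The twin at `p = 3`: conjunct (H-iii) of the K2 stub from Howard's conclusion, unconditionally -/

/-- **(H-iii) of `stub_howardOutputsOfFamily` from Howard's conclusion at the control levels**, in the binders of crux 24737:
for the twin `W′/ℚ` (`Rank1Residual.Mult W′ 3`, `ρ̄_{W′,3}` onto), `K` imaginary quadratic Heegner for `N′`, `κ` anticyclotomic,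
`γ` a topological generator, a `Λ`-adic Selmer datum `Dat` with `𝔖 = Dat.S` f.g. and a class `z ≠ 0` with `𝔖/Λz` torsion: if
Howard's conclusion holds at the control levels of `z` for all large `m` (`Stmt.conclusionAtControlLevels 3 …`, `E(K)[3] = 0` by
`baseChange_noPTorsion_of_surjective`), then `∃ C′ m₀, ∀ m ≥ m₀, #(X_tors/q_m) ≤ 3^{C′}·#((𝔖/Λz)/q_m)²` for
`X = (W′.baseChange K).selmerDualData κ hγ` — the stub's third conjunct VERBATIM.  The glue is `controlGlueMultAt_three`.
[cite: Howard2004HeegnerKolyvagin, Thm. 1.6.1 and proof of Thm. 2.2.10 (𝔮 = T^m + p)] [cite: GreenbergLNM1716, §1 p. 60] -/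
theorem twin_hKS_of_conclusion
    (W' : WeierstrassCurve ℚ) [W'.IsElliptic] [W'.IsGloballyMinimal] (N' : ℕ) [NeZero N']
    (K : Type) [Field K] [NumberField K]
    (hm3 : Rank1Residual.Mult W' 3) (hsurj : W'.HasSurjectiveModNGaloisRep 3) (hK : IsImaginaryQuadratic K)
    (hH : SatisfiesHeegnerHypothesis N' K) (κ : ZpExtension K 3) (hκ : κ.IsAnticyclotomic)
    (γ : absoluteGaloisGroup K) [hγ : Fact (κ.IsTopGenerator γ)]
    (Dat : (W'.baseChange K).LambdaAdicSelmerData κ γ) [Module.Finite (IwasawaAlgebra 3) Dat.S] (z : Dat.S)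
    (hz0 : z ≠ 0) (htor : Module.IsTorsion (IwasawaAlgebra 3) (Dat.S ⧸ Submodule.span (IwasawaAlgebra 3) {z}))
    (hconc : Stmt.conclusionAtControlLevels 3 N' W' K κ γ hγ.out
      (UniversalToricDescentTowerTorsion.baseChange_noPTorsion_of_surjective W' 3 hsurj K hK) Dat z) :
    ∃ C' m₀ : ℕ, ∀ m : ℕ, m₀ ≤ m →
      Nat.card (↥(Submodule.torsion (IwasawaAlgebra 3) ((W'.baseChange K).selmerDualData κ hγ.out).X) ⧸
        (Ideal.span {(PowerSeries.X ^ m + PowerSeries.C ((3 : ℕ) : ℤ_[3]) : IwasawaAlgebra 3)} • ⊤ :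
          Submodule (IwasawaAlgebra 3) ↥(Submodule.torsion (IwasawaAlgebra 3)
            ((W'.baseChange K).selmerDualData κ hγ.out).X))) ≤
      3 ^ C' * Nat.card ((Dat.S ⧸ Submodule.span (IwasawaAlgebra 3) {z}) ⧸
        (Ideal.span {(PowerSeries.X ^ m + PowerSeries.C ((3 : ℕ) : ℤ_[3]) : IwasawaAlgebra 3)} • ⊤ :
          Submodule (IwasawaAlgebra 3) (Dat.S ⧸ Submodule.span (IwasawaAlgebra 3) {z}))) ^ 2 := by
  haveI : Module.Finite (IwasawaAlgebra 3) ((W'.baseChange K).selmerDualData κ hγ.out).X :=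
    ((W'.baseChange K).selmerDualData κ hγ.out).module_finite_holds hγ.out
  exact card_bound_of_conclusion UniversalToricDescentTwinReadoutIndex.controlGlueMultAt_three N' W' K κ γ hK (by decide) hκ
    hH hγ.out (UniversalToricDescentTowerTorsion.baseChange_noPTorsion_of_surjective W' 3 hsurj K hK)
    (fun w hw ↦ UniversalToricDescentTwinTateLineAtThree.hasMultiplicativeReductionAt_baseChange_of_mult_three W' hm3 K w hw)
    Dat _ z htor hz0 hconc

end Summit.BirchSwinnertonDyer.BirchSwinnertonDyer.Theorems.UniversalToricDescentTwinHowardConclusion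

end
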